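import Literature.MathematicalPhysics.QuantumLattice.HubbardShiftedSliceGram
import Literature.MathematicalPhysics.QuantumLattice.HubbardSpaceTimeCharacters
import HarnessLib

/-!
# The `ℓ²` norm of the slice symbol on the space-time dual torus: `Σ_q ‖G_j(q)‖² ≤ (βL²)^{-4} · #shell · sup²`

Topic `MathematicalPhysics/QuantumLattice`; the undifferenced (`e = 0`) term of the weighted-Plancherel bound
`TorusFourierWeightedL1ProdWeight.sum_sum_norm_prodChar_le_prodWeight` for the symbol produced by
`HubbardSpaceTimeCharacters.norm_pullback_normalCovariance_le` from the shifted slice covariance of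
`HubbardShiftedSliceCovariance.lean`: `G(q) = (βL²)^{-2} F_ω(k) F_{ω′}(k) p(k,σ)`, `k = Φ(q)` the frequency–momentum of the
product-torus point `q ∈ (ℤ/2M) × (ℤ/L)²`, `p = (w_Λ - w_{Λ′})·p_θ` the slice symbol.  Reindexing back to frequency–momenta
(`sum_freqMomentum_eq_sum_prodTorus`) and using the support and the sup of the slice symbol (`HubbardShiftedSliceGram`):
`Σ_q ‖G(q)‖² ≤ ‖(βL²)⁻¹‖⁴ · #T · ((8/3)βL²/Λ)²` for any finite set `T` containing the shell, in particular
`#T ≤ (Λ′β/π + 3)·4L(Λ′L/(2π√(d₀/8)) + 1)` for thin shells (Benfatto–Giuliani–Mastropietro 2006, (2.80)/(2.81): the `L²` size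
of a single-scale propagator is its sup times the phase-space volume; cell gate-hubbard-kl, R0-SCOPE-2 §5.3 (W2)).

* `sum_prodTorus_norm_sq_eq_sum_freqMomentum` — `Σ_q ‖H(Φ q)‖² = Σ_k ‖H k‖²`;
* **`sum_norm_sq_sliceSymbol_le_card`** — `Σ_k ‖(βL²)^{-2} F F p(k,σ)‖² ≤ ‖(βL²)⁻¹‖⁴ · #T · ((8/3)βL²/Λ)²` for `T ⊇ shell`;
* **`sum_prodTorus_norm_sq_sliceSymbol_le`** — the thin-shell instance on the product torus.

Everything is proved; no definitions, no named facts.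

## Sources

G. Benfatto, A. Giuliani, V. Mastropietro, Ann. Henri Poincaré 7 (2006) 809–898, §2.8 (2.80)–(2.81) and footnote ¹
(`BenfattoGiulianiMastropietro2006`).
-/

noncomputable section

namespace Literature.MathematicalPhysics.QuantumLattice

open Literature.Probability.LatticeModels GrassmannAlgebra Finset

variable {L M : ℕ}

/-- **Reindexing a frequency–momentum `ℓ²` sum to the product torus**: with `Φ(q) = (val q₁, q₂)`,
`Σ_{q ∈ (ℤ/2M)¹ × (ℤ/L)²} ‖H(Φ q)‖² = Σ_{k} ‖H k‖²`. [folklore] -/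
private theorem sum_prodTorus_norm_sq_eq_sum_freqMomentum [NeZero L] [NeZero M] (H : FreqMomentum L M → ℂ) :
    ∑ q : TorusSite 1 (2 * M) × TorusSite 2 L, ‖H (⟨(q.1 0).val, ZMod.val_lt (q.1 0)⟩, q.2)‖ ^ 2 =
      ∑ k : FreqMomentum L M, ‖H k‖ ^ 2 := by
  rw [← sum_freqMomentum_eq_sum_prodTorus (fun q : TorusSite 1 (2 * M) × TorusSite 2 L =>
    ‖H (⟨(q.1 0).val, ZMod.val_lt (q.1 0)⟩, q.2)‖ ^ 2)]
  refine sum_congr rfl fun k _ => ?_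
  congr 3
  refine Prod.ext ?_ rfl
  exact Fin.ext (val_natCast_matsubaraIdx k.1)

/-- **The `ℓ²` norm of the slice symbol against its phase-space count**: for multipliers `‖F_ω(k)‖ ≤ 1`, `0 < β`,
`0 < Λ ≤ Λ′`, `|θ| ≤ π/(4β)` and any finite set `T` of frequency–momenta containing the support of the slice weight,
`Σ_k ‖(βL²)^{-2} F_ω(k) F_{ω′}(k) p(k,σ)‖² ≤ ‖(βL²)⁻¹‖⁴ · #T · ((8/3)βL²/Λ)²`. [cite: BenfattoGiulianiMastropietro2006, §2.8 (2.81)] -/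
theorem sum_norm_sq_sliceSymbol_le_card [NeZero L] {N : ℕ} {β : ℝ} (hβ : 0 < β) (μ : ℝ) {θ : ℝ}
    (hθ : |θ| ≤ Real.pi / (4 * β)) {Λ Λ' : ℝ} (hΛ : 0 < Λ) (hΛΛ' : Λ ≤ Λ')
    (F : Fin N → FreqMomentum L M → ℂ) (hF : ∀ ω k, ‖F ω k‖ ≤ 1) (ω ω' : Fin N) (σ : Fin 2)
    (T : Finset (FreqMomentum L M))
    (hT : ∀ k : FreqMomentum L M, hubbardCutoffWeight L M β μ Λ k - hubbardCutoffWeight L M β μ Λ' k ≠ 0 → k ∈ T) :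
    ∑ k : FreqMomentum L M, ‖(((1 / (β * (L : ℝ) ^ 2) : ℝ) : ℂ) ^ 2 *
        (F ω k * F ω' k * (((hubbardCutoffWeight L M β μ Λ k : ℂ) - (hubbardCutoffWeight L M β μ Λ' k : ℂ)) *
          shiftedFreeSymbol L M β μ θ (k, σ))))‖ ^ 2 ≤
      ‖((1 / (β * (L : ℝ) ^ 2) : ℝ) : ℂ)‖ ^ 4 * (T.card * (8 / 3 * (β * (L : ℝ) ^ 2) / Λ) ^ 2) := by
  classical
  -- termwise: `‖c² F F p‖² ≤ ‖c‖⁴ ‖p‖²`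
  have hterm : ∀ k : FreqMomentum L M, ‖(((1 / (β * (L : ℝ) ^ 2) : ℝ) : ℂ) ^ 2 *
        (F ω k * F ω' k * (((hubbardCutoffWeight L M β μ Λ k : ℂ) - (hubbardCutoffWeight L M β μ Λ' k : ℂ)) *
          shiftedFreeSymbol L M β μ θ (k, σ))))‖ ^ 2 ≤
      ‖((1 / (β * (L : ℝ) ^ 2) : ℝ) : ℂ)‖ ^ 4 *
        ‖((hubbardCutoffWeight L M β μ Λ k : ℂ) - (hubbardCutoffWeight L M β μ Λ' k : ℂ)) *
          shiftedFreeSymbol L M β μ θ (k, σ)‖ ^ 2 := by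
    intro k
    rw [norm_mul, norm_mul, norm_mul, norm_pow, mul_pow, mul_pow, mul_pow, ← pow_mul]
    have h1 : ‖F ω k‖ ^ 2 ≤ 1 := by have := hF ω k; nlinarith [norm_nonneg (F ω k)]
    have h2 : ‖F ω' k‖ ^ 2 ≤ 1 := by have := hF ω' k; nlinarith [norm_nonneg (F ω' k)]
    have h12 : ‖F ω k‖ ^ 2 * ‖F ω' k‖ ^ 2 ≤ 1 := by nlinarith [sq_nonneg ‖F ω k‖, sq_nonneg ‖F ω' k‖]
    calc ‖((1 / (β * (L : ℝ) ^ 2) : ℝ) : ℂ)‖ ^ (2 * 2) * (‖F ω k‖ ^ 2 * ‖F ω' k‖ ^ 2 *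
          ‖((hubbardCutoffWeight L M β μ Λ k : ℂ) - (hubbardCutoffWeight L M β μ Λ' k : ℂ)) *
            shiftedFreeSymbol L M β μ θ (k, σ)‖ ^ 2)
        ≤ ‖((1 / (β * (L : ℝ) ^ 2) : ℝ) : ℂ)‖ ^ (2 * 2) * (1 *
          ‖((hubbardCutoffWeight L M β μ Λ k : ℂ) - (hubbardCutoffWeight L M β μ Λ' k : ℂ)) *
            shiftedFreeSymbol L M β μ θ (k, σ)‖ ^ 2) :=
          mul_le_mul_of_nonneg_left (mul_le_mul_of_nonneg_right h12 (by positivity)) (by positivity)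
      _ = _ := by norm_num
  refine (sum_le_sum fun k _ => hterm k).trans ?_
  rw [← mul_sum]
  refine mul_le_mul_of_nonneg_left ?_ (by positivity)
  -- the support and the sup
  refine sum_le_card_mul_of_support _ (fun k => ?_) T (fun k hk => hT k ?_)
  · have h := norm_sliceSymbol_le hβ μ hθ hΛ hΛΛ' (k, σ)
    exact pow_le_pow_left₀ (norm_nonneg _) h 2
  · intro h0
    apply hk
    have : ((hubbardCutoffWeight L M β μ Λ k : ℂ) - (hubbardCutoffWeight L M β μ Λ' k : ℂ)) = 0 := by exact_mod_cast h0
    rw [this, zero_mul, norm_zero, zero_pow two_ne_zero]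

/-- **The `ℓ²` norm of the slice symbol on the space-time dual torus, thin shells**: for `‖F_ω(k)‖ ≤ 1`, `0 < β`,
`0 < Λ ≤ Λ′ ≤ d₀/2` with `μ` at distance `≥ d₀` from `{-4, 0}`, and `|θ| ≤ π/(4β)`,
`Σ_{q ∈ (ℤ/2M)×(ℤ/L)²} ‖(βL²)^{-2} F_ω F_{ω′} p(Φ q, σ)‖² ≤ ‖(βL²)⁻¹‖⁴ · (Λ′β/π + 3)·4L(Λ′L/(2π√(d₀/8)) + 1) · ((8/3)βL²/Λ)²` — the
`e = 0` term of `sum_sum_norm_prodChar_le_prodWeight` for the symbol of `norm_pullback_normalCovariance_le`.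
[cite: BenfattoGiulianiMastropietro2006, §2.8 (2.81)] -/
theorem sum_prodTorus_norm_sq_sliceSymbol_le [NeZero L] [NeZero M] {N : ℕ} {β : ℝ} (hβ : 0 < β) {μ d₀ : ℝ}
    (hμ4 : d₀ ≤ μ + 4) (hμ0 : d₀ ≤ -μ) {θ : ℝ} (hθ : |θ| ≤ Real.pi / (4 * β)) {Λ Λ' : ℝ} (hΛ : 0 < Λ) (hΛΛ' : Λ ≤ Λ')
    (hΛ'd : Λ' ≤ d₀ / 2) (F : Fin N → FreqMomentum L M → ℂ) (hF : ∀ ω k, ‖F ω k‖ ≤ 1) (ω ω' : Fin N) (σ : Fin 2) :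
    ∑ q : TorusSite 1 (2 * M) × TorusSite 2 L, ‖(((1 / (β * (L : ℝ) ^ 2) : ℝ) : ℂ) ^ 2 *
        (F ω (⟨(q.1 0).val, ZMod.val_lt (q.1 0)⟩, q.2) * F ω' (⟨(q.1 0).val, ZMod.val_lt (q.1 0)⟩, q.2) *
          (((hubbardCutoffWeight L M β μ Λ (⟨(q.1 0).val, ZMod.val_lt (q.1 0)⟩, q.2) : ℂ) -
              (hubbardCutoffWeight L M β μ Λ' (⟨(q.1 0).val, ZMod.val_lt (q.1 0)⟩, q.2) : ℂ)) *
            shiftedFreeSymbol L M β μ θ ((⟨(q.1 0).val, ZMod.val_lt (q.1 0)⟩, q.2), σ))))‖ ^ 2 ≤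
      ‖((1 / (β * (L : ℝ) ^ 2) : ℝ) : ℂ)‖ ^ 4 *
        (((Λ' * β / Real.pi + 3) * (4 * (L * (Λ' * L / (2 * Real.pi * Real.sqrt (d₀ / 8)) + 1)))) *
          (8 / 3 * (β * (L : ℝ) ^ 2) / Λ) ^ 2) := by
  classical
  have hΛ' : 0 < Λ' := hΛ.trans_le hΛΛ'
  rw [sum_prodTorus_norm_sq_eq_sum_freqMomentum (fun k : FreqMomentum L M => (((1 / (β * (L : ℝ) ^ 2) : ℝ) : ℂ) ^ 2 *
    (F ω k * F ω' k * (((hubbardCutoffWeight L M β μ Λ k : ℂ) - (hubbardCutoffWeight L M β μ Λ' k : ℂ)) *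
      shiftedFreeSymbol L M β μ θ (k, σ)))))]
  set T : Finset (FreqMomentum L M) := (univ : Finset (FreqMomentum L M)).filter fun k =>
    |matsubaraFreq β M k.1| ≤ Λ' ∧ |torusBand L k.2 - μ| < Λ' with hTdef
  have hT : ∀ k : FreqMomentum L M, hubbardCutoffWeight L M β μ Λ k - hubbardCutoffWeight L M β μ Λ' k ≠ 0 → k ∈ T := by
    intro k hw
    obtain ⟨-, hhi⟩ := support_sliceWeight hΛ hΛΛ' k hw
    rw [hTdef, mem_filter]
    refine ⟨mem_univ _, ?_, ?_⟩
    · have : matsubaraFreq β M k.1 ^ 2 ≤ Λ' ^ 2 := by nlinarith [sq_nonneg (nambuXi L μ k.2)]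
      exact abs_le_of_sq_le_sq' this hΛ'.le |>.elim (fun h1 h2 => abs_le.2 ⟨h1, h2⟩)
    · have hξ : nambuXi L μ k.2 ^ 2 < Λ' ^ 2 := by nlinarith [sq_nonneg (matsubaraFreq β M k.1)]
      have := abs_lt_of_sq_lt_sq' hξ hΛ'.le
      rw [nambuXi] at this
      exact abs_lt.2 this
  refine (sum_norm_sq_sliceSymbol_le_card hβ μ hθ hΛ hΛΛ' F hF ω ω' σ T hT).trans ?_
  refine mul_le_mul_of_nonneg_left (mul_le_mul_of_nonneg_right ?_ (by positivity)) (by positivity)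
  exact card_shellSupport_le hβ hμ4 hμ0 hΛ' hΛ'd

end Literature.MathematicalPhysics.QuantumLattice

end
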